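import Literature.Computability.MetaComplexity.GridTseitinDepthFregeLowerBound
import Literature.Computability.MetaComplexity.TseitinDepthFregeProofs
import HarnessLib

/-!
# Unconditional bounded-depth Frege lower bounds for Tseitin formulas from subdivided walls, and
# the treewidth bound with a weak exponent from the excluded-grid theorem alone

Composition of the Galesi–Itsykson–Riazanov–Sofronova reduction (`exists_gridRefutation`,
`TseitinDepthFregeProofs.lean`: a refutation of the Tseitin formula of a connected multigraph whose
row graph contains a subdivided brick graph `bricks k` yields a refutation of a grid Tseitin
formula `T(𝓗_{k,k}, f)` of depth `+ 23` and polynomial size) with the UNCONDITIONAL weak grid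
theorem `gridSystem_depthFrege_lowerBound` (`GridTseitinDepthFregeLowerBound.lean`, by the
reduction of the bijective pigeonhole principle). Results:

* `tseitin_depthFrege_lowerBound_of_brickEmbedding` — UNCONDITIONAL: for every `d` there are
  `ε > 0`, `k₀` such that for `k ≥ k₀`, every depth-`d` `textbookFrege` refutation of the Tseitin
  formula of a connected graph system whose row graph contains a subdivision of `bricks k` has size
  `≥ 2^{k^ε}`;
* `tseitin_depthFrege_lowerBound_of_wall` — the same from a wall `W_r` as a topological minor
  (`bricks k ≼ₜ W_{3k+3}`), size `≥ 2^{r^ε}`;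
* `tseitin_treewidth_depthFrege_lowerBound_of_wall` — CONDITIONAL only on the polynomial
  excluded-grid theorem in wall form with any exponent (W_δ) (Chekuri–Chuzhoy 2016; Chuzhoy–Tan
  2021, Thm. 1.1, `δ = 1/10`; GIRS Cor. 9): for every `d` there are `ε > 0`, `t₀` such that every
  depth-`d` refutation of the Tseitin formula of a connected graph system of treewidth `t ≥ t₀` has
  size `≥ 2^{t^ε}` — the GIRS theorem (APAL 2023, Thm. 18) with the weak exponent `ε_d` in place of
  `Ω(1/d)`, without Håstad's switching lemma.

References: N. Galesi, D. Itsykson, A. Riazanov, A. Sofronova, *Bounded-depth Frege complexity of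
Tseitin formulas for all graphs*, APAL 174 (2023), Thm. 18 and §3; J. Håstad, J. ACM 68 (2020),
Thm. 6.2; E. Ben-Sasson, Comput. Complexity 11 (2002); J. Chuzhoy, Z. Tan, JCTB 146 (2021),
Thm. 1.1.
-/

namespace Literature.Computability.MetaComplexity

open Complexity Complexity.PropForm Finset Literature.Combinatorics.SimpleGraph

/-! ### Numerics -/

namespace TseitinNumerics

/-- The half exponent is eventually dominated: if `x > 0` and `x ≥ 11^{2/ε}` then
`x^{ε/2} ≤ x^ε/3 - 27`. [folklore] -/
theorem half_exponent_condition {ε x : ℝ} (hε : 0 < ε) (hx0 : 0 < x)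
    (hx : (11 : ℝ) ^ (2 / ε) ≤ x) : x ^ (ε / 2) ≤ x ^ ε / 3 - 27 := by
  set u := x ^ (ε / 2) with hu
  have hu11 : 11 ≤ u := by
    calc (11 : ℝ) = ((11 : ℝ) ^ (2 / ε)) ^ (ε / 2) := by
          rw [← Real.rpow_mul (by norm_num), show 2 / ε * (ε / 2) = 1 by field_simp, Real.rpow_one]
      _ ≤ x ^ (ε / 2) := Real.rpow_le_rpow (by positivity) hx (by positivity)
  have hxe : x ^ ε = u * u := by rw [hu, ← Real.rpow_add hx0]; ring_nf
  rw [hxe]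
  nlinarith

/-- A sixth of a large base costs half the exponent: if `r ≥ 36` and `r ≤ 6k` then
`r^{ε/2} ≤ k^ε`. [folklore] -/
theorem sixth_condition {ε r k : ℝ} (hε : 0 < ε) (hr : 36 ≤ r) (hk : r ≤ 6 * k) :
    r ^ (ε / 2) ≤ k ^ ε := by
  have hr0 : 0 < r := by linarith
  have h6 : (6 : ℝ) ^ ε ≤ r ^ (ε / 2) := by
    have e : (6 : ℝ) ^ ε = (36 : ℝ) ^ (ε / 2) := by
      rw [show (36 : ℝ) = (6 : ℝ) ^ (2 : ℝ) by norm_num, ← Real.rpow_mul (by norm_num)]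
      ring_nf
    rw [e]
    exact Real.rpow_le_rpow (by norm_num) hr (by positivity)
  have hre : r ^ ε = r ^ (ε / 2) * r ^ (ε / 2) := by rw [← Real.rpow_add hr0]; ring_nf
  have h1 : (6 : ℝ) ^ ε * r ^ (ε / 2) ≤ r ^ ε := by
    rw [hre]; exact mul_le_mul_of_nonneg_right h6 (Real.rpow_nonneg hr0.le _)
  have h2 : r ^ ε ≤ (6 : ℝ) ^ ε * k ^ ε := by
    rw [← Real.mul_rpow (by norm_num) (by linarith)]
    exact Real.rpow_le_rpow hr0.le hk hε.le
  have h60 : (0 : ℝ) < (6 : ℝ) ^ ε := Real.rpow_pos_of_pos (by norm_num) _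
  exact le_of_mul_le_mul_left (h1.trans h2) h60

/-- A constant factor costs half the exponent: if `κ > 0`, `t ≥ (1/κ)^{2/e}` (`t > 0`) then
`t^{e/2} ≤ κ t^e`. [folklore] -/
theorem constant_condition {κ e t : ℝ} (hκ : 0 < κ) (he : 0 < e) (ht0 : 0 < t)
    (ht : (1 / κ) ^ (2 / e) ≤ t) : t ^ (e / 2) ≤ κ * t ^ e := by
  have h1 : 1 / κ ≤ t ^ (e / 2) := by
    calc 1 / κ = ((1 / κ) ^ (2 / e)) ^ (e / 2) := by
          rw [← Real.rpow_mul (by positivity), show 2 / e * (e / 2) = 1 by field_simp, Real.rpow_one]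
      _ ≤ t ^ (e / 2) := Real.rpow_le_rpow (by positivity) ht (by positivity)
  have hte : t ^ e = t ^ (e / 2) * t ^ (e / 2) := by rw [← Real.rpow_add ht0]; ring_nf
  have h2 : 1 ≤ κ * t ^ (e / 2) := by
    rw [div_le_iff₀ hκ] at h1; linarith
  calc t ^ (e / 2) = 1 * t ^ (e / 2) := (one_mul _).symm
    _ ≤ (κ * t ^ (e / 2)) * t ^ (e / 2) := mul_le_mul_of_nonneg_right h2 (Real.rpow_nonneg ht0.le _)
    _ = κ * t ^ e := by rw [hte]; ring

end TseitinNumerics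

/-! ### From a subdivided brick graph (unconditional) -/

/-- **Unconditional lower bound from a subdivided brick graph.** For every depth `d` there are
`ε > 0` and `k₀` such that for all `k ≥ k₀`: if the row graph `G` of a graph Tseitin system `E`
(every variable in exactly two rows or none) is connected and contains a subdivision of the brick
graph `bricks k`, then every depth-`d` `textbookFrege` proof of `¬ ofCNF (sumEncoding 1 E)` has
size at least `2^{k^ε}`. Proof: `exists_gridRefutation` (GIRS Lemmas 11–16) gives a depth-`(d+23)`
refutation of a grid Tseitin formula of `𝓗_{k,k}` of size `≤ 2^78 (S + (k+1)^2 + 1)^3`, to which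
the unconditional weak grid theorem `gridSystem_depthFrege_lowerBound` applies; `ε = ε_{d+23}/2`.
[cite: GalesiEtAl2023, Theorem 18 (proof, §3.3) — here with the weak grid exponent] -/
theorem tseitin_depthFrege_lowerBound_of_brickEmbedding (d : ℕ) :
    ∃ ε : ℝ, 0 < ε ∧ ∃ k₀ : ℕ, ∀ k : ℕ, k₀ ≤ k →
      ∀ {n m : ℕ} {E : Fin m → LinEqMod 2 n} {G : SimpleGraph (Fin m)},
      IsGraphSystem E G → G.Connected → BrickEmbedding k G →
      ∀ π : List (PropForm ℕ),
        textbookFrege.IsDepthProofOf d π (neg (PropForm.ofCNF (sumEncoding 1 E))) →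
          (2 : ℝ) ^ ((k : ℝ) ^ ε) ≤ (proofSize π : ℝ) := by
  obtain ⟨ε₀, hε₀, k₁, hgrid⟩ := gridSystem_depthFrege_lowerBound (d + 23)
  set Q : ℝ := max (max (k₁ : ℝ) 3)
    (max ((max 13 (36 / (ε₀ * Real.log 2))) ^ (2 / ε₀)) ((11 : ℝ) ^ (2 / ε₀))) with hQ
  refine ⟨ε₀ / 2, by positivity, ⌈Q⌉₊, fun k hk {n m E G} hE hconn B π hπ => ?_⟩
  have hQk : Q ≤ k := (Nat.le_ceil Q).trans (by exact_mod_cast hk)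
  have hk₁ : k₁ ≤ k := by
    have : (k₁ : ℝ) ≤ k := ((le_max_left _ _).trans (le_max_left _ _)).trans hQk
    exact_mod_cast this
  have hk3 : (3 : ℝ) ≤ k := ((le_max_right _ _).trans (le_max_left _ _)).trans hQk
  have hkM : (max 13 (36 / (ε₀ * Real.log 2))) ^ (2 / ε₀) ≤ (k : ℝ) :=
    ((le_max_left _ _).trans (le_max_right _ _)).trans hQk
  have hk11 : (11 : ℝ) ^ (2 / ε₀) ≤ (k : ℝ) := ((le_max_right _ _).trans (le_max_right _ _)).trans hQk
  -- the reduction and the grid theorem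
  obtain ⟨f, π', hπ', hsize⟩ := exists_gridRefutation hE hconn B hπ
  have hlow := hgrid k hk₁ f π' hπ'
  have hA : (2 : ℝ) ^ ((k : ℝ) ^ ε₀) ≤
      2 ^ (78 : ℕ) * ((proofSize π : ℝ) + (((k : ℝ) + 1) ^ 2 + 1)) ^ 3 := by
    have h1 : (proofSize π' : ℝ) ≤ 2 ^ (78 : ℕ) * ((proofSize π : ℝ) + ((k : ℝ) + 1) ^ 2 + 1) ^ 3 := by
      exact_mod_cast hsize
    rw [← add_assoc]
    exact hlow.trans h1
  have hP : ((k : ℝ) + 1) ^ 2 + 1 ≤ (2 : ℝ) ^ ((k : ℝ) ^ ε₀ / 3 - 27) :=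
    TseitinNumerics.poly_condition hε₀ hk3 hkM
  have hB : (k : ℝ) ^ (ε₀ / 2) ≤ (k : ℝ) ^ ε₀ / 3 - 27 :=
    TseitinNumerics.half_exponent_condition hε₀ (by linarith) hk11
  exact TseitinNumerics.size_condition (Nat.cast_nonneg _) (by positivity) hA hP hB

/-! ### From a wall (unconditional) -/

/-- **Unconditional lower bound from a wall.** For every depth `d` there are `ε > 0` and `r₀` such
that for all `r ≥ r₀`: if the row graph of a connected graph Tseitin system `E` has the wall `W_r`
as a topological minor, every depth-`d` `textbookFrege` proof of `¬ ofCNF (sumEncoding 1 E)` has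
size at least `2^{r^ε}` (`bricks k ≼ₜ W_{3k+3} ≼ₜ W_r` for `k = ⌊(r-3)/3⌋ ≥ r/6`; `ε` halves).
[cite: GalesiEtAl2023, Theorem 18 (proof, §3.3: from W_r to the grid) — weak exponent] -/
theorem tseitin_depthFrege_lowerBound_of_wall (d : ℕ) :
    ∃ ε : ℝ, 0 < ε ∧ ∃ r₀ : ℕ, ∀ r : ℕ, r₀ ≤ r →
      ∀ {n m : ℕ} {E : Fin m → LinEqMod 2 n} {G : SimpleGraph (Fin m)},
      IsGraphSystem E G → G.Connected → wall r ≼ₜ G →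
      ∀ π : List (PropForm ℕ),
        textbookFrege.IsDepthProofOf d π (neg (PropForm.ofCNF (sumEncoding 1 E))) →
          (2 : ℝ) ^ ((r : ℝ) ^ ε) ≤ (proofSize π : ℝ) := by
  obtain ⟨ε₁, hε₁, k₀, hbrick⟩ := tseitin_depthFrege_lowerBound_of_brickEmbedding d
  refine ⟨ε₁ / 2, by positivity, max (3 * k₀ + 3) 36, fun r hr {n m E G} hE hconn hwall π hπ => ?_⟩
  have hr36 : 36 ≤ r := le_of_max_le_right hr
  have hrk : 3 * k₀ + 3 ≤ r := le_of_max_le_left hr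
  set k : ℕ := (r - 3) / 3 with hk
  have hk3 : 3 * k + 3 ≤ r := by omega
  have hkr : r ≤ 6 * k := by omega
  have hk₀ : k₀ ≤ k := by omega
  obtain ⟨B⟩ := BrickEmbedding.nonempty_of_isTopologicalMinor
    (bricks_isTopologicalMinor (wall_isTopologicalMinor_of_le hk3 hwall))
  have h := hbrick k hk₀ hE hconn B π hπ
  refine le_trans ?_ h
  refine Real.rpow_le_rpow_of_exponent_le (by norm_num) ?_
  exact TseitinNumerics.sixth_condition hε₁ (by exact_mod_cast hr36) (by exact_mod_cast hkr)

/-! ### From treewidth, conditionally on the excluded-grid theorem -/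

/-- **The treewidth lower bound with a weak exponent, from the polynomial excluded-grid theorem
alone.** Assume (W_δ): `∃ δ > 0, ∃ c > 0, ∃ t₁, ∀` finite `G` with `tw(G) ≥ t₁`,
`∃ r ≥ c · tw(G)^δ` with `W_r ≼ₜ G` (GIRS Cor. 9 with Chuzhoy–Tan Thm. 1.1 gives `δ = 1/10`;
Chekuri–Chuzhoy 2016 gives `δ = 1/98`). Then for every depth `d` there are `ε > 0` and `t₀` such
that every depth-`d` `textbookFrege` refutation of the Tseitin formula of a connected graph system
whose row graph has treewidth `t ≥ t₀` has size at least `2^{t^ε}` — GIRS Theorem 18 with the weak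
exponent `ε_d` instead of `Ω(1/d)`, not using Håstad's grid theorem.
[cite: GalesiEtAl2023, Theorem 18 and Corollary 9 — weak-exponent form] -/
theorem tseitin_treewidth_depthFrege_lowerBound_of_wall
    (hwall : ∃ δ : ℝ, 0 < δ ∧ ∃ c : ℝ, 0 < c ∧ ∃ t₁ : ℕ, ∀ (V : Type) [Fintype V]
      (G : SimpleGraph V), t₁ ≤ treewidth G →
      ∃ r : ℕ, c * (treewidth G : ℝ) ^ δ ≤ r ∧ wall r ≼ₜ G) (d : ℕ) :
    ∃ ε : ℝ, 0 < ε ∧ ∃ t₀ : ℕ, ∀ {n m : ℕ} {E : Fin m → LinEqMod 2 n} {G : SimpleGraph (Fin m)},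
      IsGraphSystem E G → G.Connected → t₀ ≤ treewidth G →
      ∀ π : List (PropForm ℕ),
        textbookFrege.IsDepthProofOf d π (neg (PropForm.ofCNF (sumEncoding 1 E))) →
          (2 : ℝ) ^ ((treewidth G : ℝ) ^ ε) ≤ (proofSize π : ℝ) := by
  obtain ⟨δ, hδ, c, hc, t₁, hwall⟩ := hwall
  obtain ⟨ε₂, hε₂, r₀, hwallLB⟩ := tseitin_depthFrege_lowerBound_of_wall d
  set e : ℝ := δ * ε₂ with he
  have he0 : 0 < e := by positivity
  set κ : ℝ := c ^ ε₂ with hκ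
  have hκ0 : 0 < κ := Real.rpow_pos_of_pos hc _
  set T : ℝ := max (max (t₁ : ℝ) 1) (max (((r₀ : ℝ) / c) ^ (1 / δ)) ((1 / κ) ^ (2 / e))) with hT
  refine ⟨e / 2, by positivity, ⌈T⌉₊, fun {n m E G} hE hconn htw π hπ => ?_⟩
  have hT' : T ≤ (treewidth G : ℝ) := (Nat.le_ceil T).trans (by exact_mod_cast htw)
  have ht₁ : t₁ ≤ treewidth G := by
    have : (t₁ : ℝ) ≤ treewidth G := ((le_max_left _ _).trans (le_max_left _ _)).trans hT'
    exact_mod_cast this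
  have htw1 : (1 : ℝ) ≤ treewidth G := ((le_max_right _ _).trans (le_max_left _ _)).trans hT'
  have htw0 : (0 : ℝ) < treewidth G := by linarith
  have hTQ : ((r₀ : ℝ) / c) ^ (1 / δ) ≤ treewidth G :=
    ((le_max_left _ _).trans (le_max_right _ _)).trans hT'
  have hTκ : (1 / κ) ^ (2 / e) ≤ treewidth G := ((le_max_right _ _).trans (le_max_right _ _)).trans hT'
  -- (W_δ): a wall as a topological minor, of size `r ≥ c · tw^δ ≥ r₀`
  obtain ⟨r, hr, hwallG⟩ := hwall (Fin m) G ht₁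
  have hr₀ : (r₀ : ℝ) ≤ r :=
    (TseitinNumerics.root_condition hc hδ (Nat.cast_nonneg _) hTQ).trans hr
  have hr₀' : r₀ ≤ r := by exact_mod_cast hr₀
  have h := hwallLB r hr₀' hE hconn hwallG π hπ
  refine le_trans (Real.rpow_le_rpow_of_exponent_le (by norm_num) ?_) h
  -- `tw^{e/2} ≤ κ tw^e = (c tw^δ)^{ε₂} ≤ r^{ε₂}`
  have htwδ : 0 ≤ (treewidth G : ℝ) ^ δ := Real.rpow_nonneg htw0.le _
  calc (treewidth G : ℝ) ^ (e / 2) ≤ κ * (treewidth G : ℝ) ^ e :=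
        TseitinNumerics.constant_condition hκ0 he0 htw0 hTκ
    _ = (c * (treewidth G : ℝ) ^ δ) ^ ε₂ := by
        rw [hκ, he, Real.mul_rpow hc.le htwδ, ← Real.rpow_mul htw0.le]
    _ ≤ (r : ℝ) ^ ε₂ := Real.rpow_le_rpow (by positivity) hr hε₂.le

end Literature.Computability.MetaComplexity
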